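import Summits.BirchSwinnertonDyer.BirchSwinnertonDyer.Theorems.DefiniteThetaDerivedHeightCapTowerSqrtCyclicGroupRing
import Mathlib.Data.Nat.Choose.Factorization
import Mathlib.RingTheory.AdicCompletion.Basic
import Literature.NumberTheory.EllipticCurves.ZpExtensionPadicUnitsProofs
import Mathlib.Algebra.Polynomial.Div
import Mathlib.Algebra.Polynomial.RingDivision
import HarnessLib

/-!
# `p`-adic jets: the coefficients of `ω_e · R` below degree `k` are divisible by `p^{e−k}`; `p^{eρ} X^i ∈ (X^ρ, ω_e)`;
# `p`-adic limits of coherent sequences; `X^{2ρ} ∣ A·B ⇒ X^ρ ∣ A ∨ X^ρ ∣ B`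

Route-independent `Theorems` file (cell `b2b-bsdres`, seat `b2b-bsdres-x10b`, gen 44), part 2 of the series «tower square root»
serving crux `DerivedHeightCap` (stmt-BirchSwinnertonDyer-18438, route DefiniteTheta), registered stub `stub_towerSqrt`.
HONEST FRAMING: no curve asserted, no class closed, BSD not proved by any of this.

The four elementary inputs of the finite-level ("jet") proof of the square root along a `ℤ_p`-tower (part 3), replacing the
Iwasawa algebra `Λ = ℤ_p⟦T⟧ = lim ℤ_p[T]/(ω_e)` of Bertolini–Darmon 2005 §1.2 / Washington §7.1 by congruences:

* §1 `pow_dvd_choose_prime_pow`: `p^{e−k} ∣ C(p^e, j)` for `1 ≤ j ≤ k` (Kummer), hence `coeff_k (ω_e · R) ∈ p^{e−k} ℤ_p` for every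
  polynomial `R` (`pow_dvd_coeff_omegaPoly_mul`): two polynomials congruent mod `ω_e` have `p`-adically close low coefficients;
* §2 `C_pow_mul_X_pow_mem_span`: `p^{eρ} X^i ∈ (X^ρ, ω_e)` for `i ≥ 1` (`ω_e = X·v`, `v = p^e + X w`, `v ∣ p^{eρ} − (−Xw)^ρ`);
* §3 `exists_padic_limit`: a sequence `f : ℕ → ℤ_p` with `p^{N n} ∣ f m − f n` (`n ≤ m`, `N` unbounded) has a
  limit `L` with `p^{N n} ∣ L − f n` (`ℤ_p` is `p`-adically complete: Mathlib `IsAdicComplete (𝔪) ℤ_[p]`; `⋂ p^n ℤ_p = 0` is the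
  tree's `ZpExtension.PadicUnits.eq_zero_of_forall_pow_dvd`);
* §4 `X_pow_dvd_or_of_X_pow_dvd_mul`: `X^{2ρ} ∣ A B ⇒ X^ρ ∣ A ∨ X^ρ ∣ B` in `ℤ_p[X]` (trailing degrees add in a domain).

## References
* [Washington1997] §7.1 (the polynomials `ω_n`, `Λ ≅ lim ℤ_p[T]/(ω_n)`), Prop. 7.2.
* [BertoliniDarmon2005] §1.2 (18)–(21).
-/

noncomputable section

open scoped BigOperators Polynomial

-- D-0017: single-problem summit, the namespace repeats the problem name by design.
set_option linter.dupNamespace false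

namespace Summit.BirchSwinnertonDyer.BirchSwinnertonDyer.Theorems.TowerSqrt

variable (p : ℕ) [hp : Fact p.Prime]

/-! ### §1 Kummer: `p^{e−k} ∣ C(p^e, j)` for `1 ≤ j ≤ k`; low coefficients of multiples of `ω_e` -/

omit hp in
/-- **Kummer for `C(p^e, j)`**: `p^{e − k} ∣ C(p^e, j)` whenever `1 ≤ j ≤ k` (`v_p C(p^e, j) = e − v_p(j)` and `v_p(j) ≤ j ≤ k`).
[folklore] -/
theorem pow_dvd_choose_prime_pow (hp' : p.Prime) (e j k : ℕ) (hj1 : 1 ≤ j) (hjk : j ≤ k) :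
    p ^ (e - k) ∣ (p ^ e).choose j := by
  by_cases hje : j ≤ p ^ e
  · have hj0 : j ≠ 0 := by omega
    have hfac := Nat.factorization_choose_prime_pow hp' hje hj0
    have hpos : (p ^ e).choose j ≠ 0 := (Nat.choose_pos hje).ne'
    rw [hp'.pow_dvd_iff_le_factorization hpos, hfac]
    have hjfac : j.factorization p ≤ k :=
      (Nat.factorization_le_of_le_pow (le_of_lt (Nat.lt_pow_self hp'.one_lt))).trans hjk
    omega
  · rw [Nat.choose_eq_zero_of_lt (not_le.mp hje)]
    exact dvd_zero _

/-- The coefficients of `ω_e`: `p^{e−k} ∣ coeff_j ω_e` for all `j ≤ k` (`coeff_0 = 0`, `coeff_j = C(p^e, j)`). [folklore] -/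
theorem pow_dvd_coeff_omegaPoly (e j k : ℕ) (hjk : j ≤ k) : (p : ℤ_[p]) ^ (e - k) ∣ (((Polynomial.X + 1 : ℤ_[p][X]) ^ (p ^ e) - 1)).coeff j := by
  rw [coeff_omegaPoly]
  split_ifs with h0
  · exact dvd_zero _
  · have h := pow_dvd_choose_prime_pow p hp.out e j k (Nat.one_le_iff_ne_zero.mpr h0) hjk
    have := Nat.cast_dvd_cast (α := ℤ_[p]) h
    push_cast at this
    exact this

/-- **`coeff_k (ω_e · R) ∈ p^{e−k} ℤ_p`** for every polynomial `R`. [folklore] -/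
theorem pow_dvd_coeff_omegaPoly_mul (e k : ℕ) (R : ℤ_[p][X]) :
    (p : ℤ_[p]) ^ (e - k) ∣ (((Polynomial.X + 1 : ℤ_[p][X]) ^ (p ^ e) - 1) * R).coeff k := by
  rw [Polynomial.coeff_mul]
  refine Finset.dvd_sum fun ij hij => ?_
  have hle : ij.1 ≤ k := by
    have := Finset.mem_antidiagonal.mp hij
    omega
  exact dvd_mul_of_dvd_left (pow_dvd_coeff_omegaPoly p e ij.1 k hle) _

/-- Hence: if `ω_e ∣ F − F'` then `p^{e−k} ∣ coeff_k F − coeff_k F'`. [folklore] -/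
theorem pow_dvd_coeff_sub_of_omegaPoly_dvd (e k : ℕ) {F F' : ℤ_[p][X]} (h : ((Polynomial.X + 1 : ℤ_[p][X]) ^ (p ^ e) - 1) ∣ F - F') :
    (p : ℤ_[p]) ^ (e - k) ∣ F.coeff k - F'.coeff k := by
  obtain ⟨R, hR⟩ := h
  rw [← Polynomial.coeff_sub, hR]
  exact pow_dvd_coeff_omegaPoly_mul p e k R

/-- `ω_a ∣ ω_b` for `a ≤ b` (`(X+1)^{p^a} − 1 ∣ ((X+1)^{p^a})^{p^{b−a}} − 1`). [folklore] -/
theorem omegaPoly_dvd_omegaPoly {a b : ℕ} (hab : a ≤ b) : ((Polynomial.X + 1 : ℤ_[p][X]) ^ (p ^ a) - 1) ∣ ((Polynomial.X + 1 : ℤ_[p][X]) ^ (p ^ b) - 1) := by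
  have h : ((Polynomial.X + 1 : ℤ_[p][X]) ^ (p ^ b) - 1) = ((Polynomial.X + 1 : ℤ_[p][X]) ^ (p ^ a)) ^ (p ^ (b - a)) - 1 := by
    rw [← pow_mul, ← pow_add, Nat.add_sub_cancel' hab]
  rw [h]
  simpa using sub_dvd_pow_sub_pow ((Polynomial.X + 1 : ℤ_[p][X]) ^ (p ^ a)) 1 (p ^ (b - a))

/-! ### §2 `p^{eρ} X^i ∈ (X^ρ, ω_e)` for `i ≥ 1` -/

/-- `ω_e = X · v` with `v(0) = p^e`: the factorisation through the vanishing constant term. [folklore] -/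
theorem exists_omegaPoly_eq_X_mul (e : ℕ) :
    ∃ v : ℤ_[p][X], ((Polynomial.X + 1 : ℤ_[p][X]) ^ (p ^ e) - 1) = Polynomial.X * v ∧ v.coeff 0 = (p : ℤ_[p]) ^ e := by
  have h0 : (((Polynomial.X + 1 : ℤ_[p][X]) ^ (p ^ e) - 1)).coeff 0 = 0 := by rw [coeff_omegaPoly]; simp
  obtain ⟨v, hv⟩ := Polynomial.X_dvd_iff.mpr h0
  refine ⟨v, hv, ?_⟩
  have h1 : (((Polynomial.X + 1 : ℤ_[p][X]) ^ (p ^ e) - 1)).coeff 1 = (p : ℤ_[p]) ^ e := by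
    rw [coeff_omegaPoly]; simp
  rw [← h1, hv, Polynomial.coeff_X_mul]

/-- **`p^{eρ} X^i ∈ (X^ρ, ω_e)` for `i ≥ 1`**: with `ω_e = Xv`, `v = p^e + Xw`, `v ∣ (p^e)^ρ − (−Xw)^ρ`, so
`p^{eρ} X^i = ω_e · X^{i−1} S ± X^ρ · X^i w^ρ`. [folklore] -/
theorem C_pow_mul_X_pow_mem_span (e ρ i : ℕ) (hi : 1 ≤ i) :
    Polynomial.C ((p : ℤ_[p]) ^ (e * ρ)) * Polynomial.X ^ i ∈
      Ideal.span {Polynomial.X ^ ρ, ((Polynomial.X + 1 : ℤ_[p][X]) ^ (p ^ e) - 1)} := by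
  obtain ⟨v, hv, hv0⟩ := exists_omegaPoly_eq_X_mul p e
  -- v = C (p^e) + X * w
  have hw0 : (v - Polynomial.C ((p : ℤ_[p]) ^ e)).coeff 0 = 0 := by
    rw [Polynomial.coeff_sub, hv0, Polynomial.coeff_C_zero, sub_self]
  obtain ⟨w, hw⟩ := Polynomial.X_dvd_iff.mpr hw0
  have hvw : Polynomial.C ((p : ℤ_[p]) ^ e) = v - Polynomial.X * w := by
    rw [← hw]; ring
  -- v ∣ (v - Xw)^ρ - (-Xw)^ρ
  obtain ⟨S, hS⟩ := sub_dvd_pow_sub_pow (v - Polynomial.X * w) (-(Polynomial.X * w)) ρ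
  have hvS : (v - Polynomial.X * w - -(Polynomial.X * w)) = v := by ring
  rw [hvS] at hS
  -- p^{eρ} = v S + (-Xw)^ρ
  have hpow : Polynomial.C ((p : ℤ_[p]) ^ (e * ρ)) = v * S + (-(Polynomial.X * w)) ^ ρ := by
    rw [pow_mul, map_pow, hvw, ← hS, sub_add_cancel]
  obtain ⟨i', rfl⟩ := Nat.exists_eq_add_of_le hi
  rw [Ideal.mem_span_pair]
  refine ⟨(-1) ^ ρ * Polynomial.X ^ (1 + i') * w ^ ρ, Polynomial.X ^ i' * S, ?_⟩
  rw [hpow, hv]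
  ring

/-- The jet polynomial `Σ_{i<ρ} a_i X^i` has coefficients `a_d` below `ρ`. [folklore] -/
theorem coeff_sum_range_C_mul_X_pow (a : ℕ → ℤ_[p]) (ρ d : ℕ) (hd : d < ρ) :
    (∑ i ∈ Finset.range ρ, Polynomial.C (a i) * Polynomial.X ^ i).coeff d = a d := by
  rw [Polynomial.finsetSum_coeff]
  simp_rw [Polynomial.coeff_C_mul_X_pow]
  rw [Finset.sum_ite_eq (Finset.range ρ) d (fun i => a i), if_pos (Finset.mem_range.mpr hd)]

/-- `X^ρ` divides `F` minus its low part. [folklore] -/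
theorem X_pow_dvd_sub_sum_range (F : ℤ_[p][X]) (ρ : ℕ) :
    Polynomial.X ^ ρ ∣ F - ∑ i ∈ Finset.range ρ, Polynomial.C (F.coeff i) * Polynomial.X ^ i := by
  rw [Polynomial.X_pow_dvd_iff]
  intro d hd
  rw [Polynomial.coeff_sub, coeff_sum_range_C_mul_X_pow p (fun i => F.coeff i) ρ d hd, sub_self]

/-- Membership in `(X^ρ, ω_e)` from coefficients: a polynomial with zero constant term whose coefficients in degrees
`1 ≤ i < ρ` are all divisible by `p^{eρ}` lies in `(X^ρ, ω_e)`. [folklore] -/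
theorem mem_span_of_coeff (e ρ : ℕ) (F : ℤ_[p][X]) (h0 : F.coeff 0 = 0)
    (hlow : ∀ i, 1 ≤ i → i < ρ → (p : ℤ_[p]) ^ (e * ρ) ∣ F.coeff i) :
    F ∈ Ideal.span {Polynomial.X ^ ρ, ((Polynomial.X + 1 : ℤ_[p][X]) ^ (p ^ e) - 1)} := by
  set R := ∑ i ∈ Finset.range ρ, Polynomial.C (F.coeff i) * Polynomial.X ^ i with hR
  have hsplit : F = (F - R) + R := by ring
  rw [hsplit]
  refine Ideal.add_mem _ ?_ ?_
  · obtain ⟨Q, hQ⟩ := X_pow_dvd_sub_sum_range p F ρ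
    rw [hQ]
    exact Ideal.mul_mem_right _ _ (Ideal.subset_span (Set.mem_insert _ _))
  · refine Ideal.sum_mem _ fun i hi => ?_
    have hiρ : i < ρ := Finset.mem_range.mp hi
    by_cases hi0 : i = 0
    · rw [hi0, h0, map_zero, zero_mul]
      exact Ideal.zero_mem _
    · have hi1 : 1 ≤ i := Nat.one_le_iff_ne_zero.mpr hi0
      obtain ⟨c, hc⟩ := hlow i hi1 hiρ
      have : Polynomial.C (F.coeff i) * Polynomial.X ^ i =
          Polynomial.C c * (Polynomial.C ((p : ℤ_[p]) ^ (e * ρ)) * Polynomial.X ^ i) := by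
        rw [hc, map_mul]; ring
      rw [this]
      exact Ideal.mul_mem_left _ _ (C_pow_mul_X_pow_mem_span p e ρ i hi1)

/-! ### §3 `p`-adic limits of coherent sequences in `ℤ_p` -/

/-- Membership in `𝔪^n • ⊤ ⊆ ℤ_p` is divisibility by `p^n`. [folklore] -/
theorem mem_maximalIdeal_pow_smul_top_iff (n : ℕ) (x : ℤ_[p]) :
    x ∈ (IsLocalRing.maximalIdeal ℤ_[p] ^ n • ⊤ : Submodule ℤ_[p] ℤ_[p]) ↔ (p : ℤ_[p]) ^ n ∣ x := by
  rw [smul_eq_mul, Ideal.mul_top, PadicInt.maximalIdeal_eq_span_p, Ideal.span_singleton_pow, Ideal.mem_span_singleton]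

/-- An element divisible by `p^{N n}` for an unbounded `N` is `0`. [folklore] -/
theorem eq_zero_of_forall_pow_dvd' {x : ℤ_[p]} (N : ℕ → ℕ) (hN : ∀ i : ℕ, ∃ n, i ≤ N n)
    (h : ∀ n : ℕ, (p : ℤ_[p]) ^ N n ∣ x) : x = 0 := by
  refine Literature.NumberTheory.EllipticCurves.ZpExtension.PadicUnits.eq_zero_of_forall_pow_dvd (p := p) fun i => ?_
  obtain ⟨n, hn⟩ := hN i
  exact (pow_dvd_pow _ hn).trans (h n)

/-- **`p`-adic limits**: a sequence `f : ℕ → ℤ_p` with `p^{N n} ∣ f m − f n` for `n ≤ m`, `N` monotone and unbounded, has a limit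
`L ∈ ℤ_p` with `p^{N n} ∣ L − f n` for every `n` (completeness of `ℤ_p`, Mathlib `IsAdicComplete (𝔪) ℤ_[p]`; no monotonicity of `N`
is needed: the precision of a difference is the minimum of the two levels). [folklore] -/
theorem exists_padic_limit (f : ℕ → ℤ_[p]) (N : ℕ → ℕ) (hN : ∀ i : ℕ, ∃ n, i ≤ N n)
    (hf : ∀ n m, n ≤ m → (p : ℤ_[p]) ^ N n ∣ f m - f n) :
    ∃ L : ℤ_[p], ∀ n, (p : ℤ_[p]) ^ N n ∣ L - f n := by
  classical
  -- reindex: ν i is a level of precision ≥ i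
  let ν : ℕ → ℕ := fun i => Nat.find (hN i)
  have hν : ∀ i, i ≤ N (ν i) := fun i => Nat.find_spec (hN i)
  -- key estimate: p^{min-precision} divides differences, in both orders
  have hdiff : ∀ a b, (p : ℤ_[p]) ^ min (N a) (N b) ∣ f a - f b := by
    intro a b
    rcases le_total a b with hab | hab
    · have h1 := hf a b hab
      rw [← dvd_neg, neg_sub] at h1
      exact (pow_dvd_pow _ (min_le_left _ _)).trans h1
    · exact (pow_dvd_pow _ (min_le_right _ _)).trans (hf b a hab)
  let g : ℕ → ℤ_[p] := fun i => f (ν i)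
  have hg : ∀ {m n}, m ≤ n → g m ≡ g n [SMOD (IsLocalRing.maximalIdeal ℤ_[p] ^ m • ⊤ : Submodule ℤ_[p] ℤ_[p])] := by
    intro m n hmn
    rw [SModEq.sub_mem, mem_maximalIdeal_pow_smul_top_iff]
    refine (pow_dvd_pow _ ?_).trans (hdiff (ν m) (ν n))
    exact le_min (hν m) (hmn.trans (hν n))
  obtain ⟨L, hL⟩ := IsPrecomplete.prec
    (inferInstance : IsAdicComplete (IsLocalRing.maximalIdeal ℤ_[p]) ℤ_[p]).toIsPrecomplete @hg
  refine ⟨L, fun n => ?_⟩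
  have h1 : (p : ℤ_[p]) ^ N n ∣ g (N n) - L := by
    have := hL (N n)
    rwa [SModEq.sub_mem, mem_maximalIdeal_pow_smul_top_iff] at this
  have h2 : (p : ℤ_[p]) ^ N n ∣ f (ν (N n)) - f n :=
    (pow_dvd_pow _ (le_min (hν (N n)) le_rfl)).trans (hdiff (ν (N n)) n)
  have : L - f n = (f (ν (N n)) - f n) - (g (N n) - L) := by simp only [g]; ring
  rw [this]
  exact dvd_sub h2 h1

/-! ### §4 `X^{2ρ} ∣ A·B ⇒ X^ρ ∣ A ∨ X^ρ ∣ B` -/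

/-- The low coefficients of a product of jet polynomials are the Cauchy products of the jets. [folklore] -/
theorem coeff_jet_mul_jet (a b : ℕ → ℤ_[p]) (N k : ℕ) (hk : k < N) :
    ((∑ i ∈ Finset.range N, Polynomial.C (a i) * Polynomial.X ^ i) *
      (∑ j ∈ Finset.range N, Polynomial.C (b j) * Polynomial.X ^ j)).coeff k =
      ∑ ij ∈ Finset.antidiagonal k, a ij.1 * b ij.2 := by
  rw [Polynomial.coeff_mul]
  refine Finset.sum_congr rfl fun ij hij => ?_
  have h := Finset.mem_antidiagonal.mp hij
  rw [coeff_sum_range_C_mul_X_pow p a N ij.1 (by omega), coeff_sum_range_C_mul_X_pow p b N ij.2 (by omega)]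

/-- A jet polynomial divisible by `X^ρ` has vanishing jets below `ρ`. [folklore] -/
theorem jet_eq_zero_of_X_pow_dvd (a : ℕ → ℤ_[p]) (N ρ : ℕ) (hρ : ρ ≤ N)
    (h : Polynomial.X ^ ρ ∣ ∑ i ∈ Finset.range N, Polynomial.C (a i) * Polynomial.X ^ i) :
    ∀ i, i < ρ → a i = 0 := by
  intro i hi
  have := (Polynomial.X_pow_dvd_iff.mp h) i hi
  rwa [coeff_sum_range_C_mul_X_pow p a N i (lt_of_lt_of_le hi hρ)] at this


/-- **Square root of `X^{2ρ}`-divisibility in the domain `ℤ_p[X]`**: if `X^{2ρ} ∣ A B` then `X^ρ ∣ A` or `X^ρ ∣ B`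
(trailing degrees add). [folklore] -/
theorem X_pow_dvd_or_of_X_pow_dvd_mul (ρ : ℕ) {A B : ℤ_[p][X]} (h : Polynomial.X ^ (2 * ρ) ∣ A * B) :
    Polynomial.X ^ ρ ∣ A ∨ Polynomial.X ^ ρ ∣ B := by
  by_cases hA : A = 0
  · left; rw [hA]; exact dvd_zero _
  by_cases hB : B = 0
  · right; rw [hB]; exact dvd_zero _
  have hAB : A * B ≠ 0 := mul_ne_zero hA hB
  have hle : 2 * ρ ≤ (A * B).natTrailingDegree :=
    Polynomial.le_natTrailingDegree hAB (fun m hm => (Polynomial.X_pow_dvd_iff.mp h) m hm)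
  rw [Polynomial.natTrailingDegree_mul hA hB] at hle
  rcases le_or_gt ρ A.natTrailingDegree with hρ | hρ
  · left
    exact Polynomial.X_pow_dvd_iff.mpr fun d hd => Polynomial.coeff_eq_zero_of_lt_natTrailingDegree (hd.trans_le hρ)
  · right
    have hρB : ρ ≤ B.natTrailingDegree := by omega
    exact Polynomial.X_pow_dvd_iff.mpr fun d hd => Polynomial.coeff_eq_zero_of_lt_natTrailingDegree (hd.trans_le hρB)

end Summit.BirchSwinnertonDyer.BirchSwinnertonDyer.Theorems.TowerSqrt

end
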